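import Summits.FinalStateConjecture.FinalStateConjecture.Theorems.BartnikGapSettlingBondiBartnikRigidityMarchingLemmaCollarSetPast
import Summits.FinalStateConjecture.FinalStateConjecture.Theorems.BartnikGapSettlingBondiBartnikRigidityStationaryKerrCollarRouteOriented
import Mathlib.Topology.MetricSpace.Thickening
import HarnessLib

/-!
# K2b-5 `stub_marchingLemma`, brick 23: the march data — line `direct-method-on-the-cone`
# (crux `BondiBartnikRigidity`, stmt-FinalStateConjecture-10807)

`march_setup`: from the boundary-collar-chart hypothesis of `K2Route.MarchingLemma` (a boundary collar
chart for every `ρ`) and the target height `T₀`, the choice of the constants `T₁, w₀, ρ, η, h`, of the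
boundary collar chart `(O, Ψ_E)`, and of the COLLAR SET
`F = {x ∈ W : t* + (2/3) r < w₀ ∧ ∃ s ∈ (0, η), T_{−s} x ∉ J⁺_K(slab)}`, with the properties the marching
consumes (report K2b-a2 §4): `F ⊆ E = Δ½ ∪ (O ∩ W)` (`η` below the thickening radius of the compact roof
portion inside `O` and below the size of a slab-corner box inside `O`, `CollarK.collarSet_subset_collar`);
the points of `W` below `η` are in `F`; the points of `W ∩ {t* < T₁}` `2h`-close to the roof portion are in
`F` (`2h` below the thickening radius of the roof portion inside `{x : T_{−η/2} x ∉ J⁺_K(slab)}`); every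
floor point has a neighbourhood whose `W ∩ {t* < T₁}`-points are in `F`.

References: Dafermos–Rodnianski arXiv:0811.0354, §5.1 [DafermosRodnianski2008].  No definitions, no named facts.
-/

noncomputable section

-- D-0017: single-problem summit, `Summit.<S>.<S>.…` by design (cf. lakefile `weak.linter.dupNamespace`).
set_option linter.dupNamespace false
set_option maxSynthPendingDepth 3

open Set Filter Function Topology TopologicalSpace Metric
open Literature.Geometry.Lorentzian
open scoped Manifold ContDiff Topology ENNReal

namespace Summit.FinalStateConjecture.FinalStateConjecture.Theorems.BondiBartnikRigidity.DirectMethod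

namespace SetupK

open FutureK (translate_mem_region)
open K2Route (IsBoundaryCollarChart slabDiamondHalfK)

set_option maxHeartbeats 1600000 in
/-- **The march data** (see the module docstring). [cite: DafermosRodnianski2008, §5.1] -/
theorem march_setup [Kerr.Facts] {𝒮 : Spacetime.{0} 4} {M a : ℝ} (hM : 0 < M) (ha : |a| < M)
    (hcyl : {y : Kerr.region a M | 0 ≤ y.1 0 ∧ Kerr.radius a y.1 ≤ 3 * M} ⊆ JK M a hM (slabK M a))
    (hfr : frontier (JK M a hM (slabK M a)) ⊆ slabK M a ∪ JK M a hM (outerSphereK M a))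
    {mo : lorentzGroup × E4} {B : ModelBackground} {C : Set 𝒮.carrier} {Φ₀ : B.domain → 𝒮.carrier}
    (hcoll : ∀ ρ : ℝ, ∃ (O : Set (Kerr.region a M)) (Ψ : B.domain → 𝒮.carrier),
      IsBoundaryCollarChart mo M a hM B C (𝒮.metric.causalFuture 𝒮.timeOrientation C) Φ₀ ρ O Ψ)
    (T₀ : ℝ) :
    ∃ (O F : Set (Kerr.region a M)) (ΨE : B.domain → 𝒮.carrier) (h η w₀ ρ T₁ : ℝ),
      (0 < h ∧ 4 * h < M ∧ 8 * h ≤ η ∧ 0 < η ∧ η ≤ 1 ∧ max T₀ 0 + 1 ≤ T₁ ∧ T₁ ≤ w₀ ∧ 2 * M + 2 ≤ w₀ ∧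
        3 / 2 * w₀ ≤ ρ ∧ 3 * M + 3 * w₀ ≤ ρ) ∧
      (∀ x : Kerr.region a M, x ∈ F ↔ x ∈ interior (JK M a hM (slabK M a)) ∧
        x.1 0 + 2 / 3 * Kerr.radius a x.1 < w₀ ∧ ∃ s, 0 < s ∧ s < η ∧
          (⟨x.1 + (-s) • E4.basisVector 0, translate_mem_region x (-s)⟩ : Kerr.region a M) ∉ JK M a hM (slabK M a)) ∧
      roofK M a hM ∩ {y | Kerr.radius a y.1 ≤ ρ} ⊆ O ∧
      F ⊆ slabDiamondHalfK M a ∪ (O ∩ interior (JK M a hM (slabK M a))) ∧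
      IsOpen (slabDiamondHalfK M a ∪ (O ∩ interior (JK M a hM (slabK M a)))) ∧
      ContMDiffOn 𝓘(ℝ, E4) (𝓡 4) ∞ ΨE (pullK mo M a B (slabDiamondHalfK M a ∪ (O ∩ interior (JK M a hM (slabK M a))))) ∧
      IsOpenEmbedding ((pullK mo M a B (slabDiamondHalfK M a ∪ (O ∩ interior (JK M a hM (slabK M a))))).restrict ΨE) ∧
      ΨE '' pullK mo M a B (slabDiamondHalfK M a ∪ (O ∩ interior (JK M a hM (slabK M a)))) ⊆
        𝒮.metric.causalFuture 𝒮.timeOrientation C ∧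
      supCkENorm (Subtype.val '' pullK mo M a B (slabDiamondHalfK M a ∪ (O ∩ interior (JK M a hM (slabK M a))))) 0
        (𝒮.deviationExtend B ΨE) ≤ 0 ∧
      ContinuousOn ΨE (pullK mo M a B (slabDiamondHalfK M a ∪ (O ∩ interior (JK M a hM (slabK M a))) ∪ slabK M a ∪
        (O ∩ roofK M a hM))) ∧
      ΨE '' pullK mo M a B (O ∩ roofK M a hM) ⊆ frontier (𝒮.metric.causalFuture 𝒮.timeOrientation C) ∧
      (∀ x ∈ pullK mo M a B (slabK M a), ΨE x = Φ₀ x) ∧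
      (∀ x ∈ interior (JK M a hM (slabK M a)), x.1 0 < T₁ →
        (∃ z ∈ frontier (JK M a hM (slabK M a)), 0 ≤ z.1 0 ∧ z.1 0 ≤ w₀ ∧ 3 * M ≤ Kerr.radius a z.1 ∧
          Kerr.radius a z.1 ≤ ρ ∧ dist x z ≤ 2 * h) → x ∈ F) ∧
      (∀ y ∈ slabK M a ∪ roofK M a hM ∩ {y | Kerr.radius a y.1 ≤ ρ}, ∃ Nb ∈ 𝓝 y,
        ∀ x ∈ Nb, x ∈ interior (JK M a hM (slabK M a)) → x.1 0 < T₁ → x ∈ F) ∧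
      (∀ x ∈ interior (JK M a hM (slabK M a)), x.1 0 < η → x ∈ F) := by
  classical
  set W := interior (JK M a hM (slabK M a)) with hWdef
  have hJc := FutureK.isClosed_JK_slabK hM hfr
  have hW0 : ∀ x ∈ W, 0 < x.1 0 := fun x hx => FutureK.interior_JK_slabK_pos hM ha hx
  have hWr : ∀ x ∈ W, 2 * Kerr.radius a x.1 ≤ 6 * M + 3 * x.1 0 := fun x hx =>
    (FrontierK.JK_slabK_subset hM ha (interior_subset hx)).2
  /- ### constants -/
  set T₁ := max T₀ 0 + 2 with hT₁
  set w₀ := 2 * T₁ + 2 * M + 2 with hw₀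
  set ρ := 3 * M + 3 * w₀ + 1 with hρ
  have hT₁0 : 2 ≤ T₁ := by rw [hT₁]; linarith [le_max_right T₀ 0]
  have hw₀0 : 0 ≤ w₀ := by rw [hw₀]; linarith
  /- ### the boundary collar chart -/
  obtain ⟨O, ΨE, hOo, hOρ, hsE, heE, himgE, hdE, hcontE, hroofE, hslabE⟩ := hcoll ρ
  set E : Set (Kerr.region a M) := slabDiamondHalfK M a ∪ (O ∩ W) with hEdef
  have hEo : IsOpen E := by
    refine IsOpen.union ?_ (hOo.inter isOpen_interior)
    exact (isOpen_lt continuous_const (K2Route.continuous_tstar a M)).inter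
      (isOpen_lt ((K2Route.continuous_tstar a M).add ((K2Route.continuous_radius_region a M).div_const _))
        continuous_const)
  /- ### the roof portion and its thickening inside `O` -/
  set Kr : Set (Kerr.region a M) := frontier (JK M a hM (slabK M a)) ∩
    {y | 0 ≤ y.1 0 ∧ y.1 0 ≤ w₀ ∧ 3 * M ≤ Kerr.radius a y.1 ∧ Kerr.radius a y.1 ≤ ρ} with hKr
  have hKrc : IsCompact Kr := CollarK.isCompact_roofPortion hM ρ w₀
  have hKrR : Kr ⊆ roofK M a hM ∩ {y | Kerr.radius a y.1 ≤ ρ} := fun y hy =>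
    ⟨CollarK.mem_roofK_of_mem_frontier hM hfr hy.1 hy.2.2.2.1, hy.2.2.2.2⟩
  obtain ⟨δ₁, hδ₁, hδ₁O⟩ := hKrc.exists_cthickening_subset_open hOo (hKrR.trans hOρ)
  /- ### the slab corner inside `O` -/
  set ε : ℕ → ℝ := fun n => M / 4 / (n + 1) with hε
  have hεpos : ∀ n, 0 < ε n := fun n => by rw [hε]; positivity
  have hεle : ∀ n, ε n ≤ M / 4 := fun n => by
    rw [hε]; exact div_le_self (by positivity) (by have := n.cast_nonneg (α := ℝ); linarith)
  have hεanti : ∀ m n : ℕ, m ≤ n → ε n ≤ ε m := fun m n hmn => by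
    rw [hε]; exact div_le_div_of_nonneg_left (by positivity) (by positivity) (by exact_mod_cast Nat.add_le_add_right hmn 1)
  set V : ℕ → Set (Kerr.region a M) := fun n =>
    {y | 0 ≤ y.1 0 ∧ y.1 0 ≤ ε n ∧ 3 * M - 2 * ε n ≤ Kerr.radius a y.1 ∧ Kerr.radius a y.1 ≤ 3 * M} with hV
  have hVc : ∀ n, IsCompact (V n) := fun n =>
    PastK.isCompact_coordSlab (a := a) (by rw [max_eq_left hM.le]; linarith [hεle n]) 0 (ε n) (3 * M)
  have hVanti : Antitone V := fun m n hmn y hy =>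
    ⟨hy.1, hy.2.1.trans (hεanti m n hmn), le_trans (by linarith [hεanti m n hmn]) hy.2.2.1, hy.2.2.2⟩
  have hVdir : Directed (· ⊇ ·) V := hVanti.directed_ge
  have hVO : ∀ y ∈ ⋂ n, V n, O ∈ 𝓝 y := by
    intro y hy
    rw [mem_iInter] at hy
    have ht : y.1 0 = 0 := by
      refine le_antisymm ?_ (hy 0).1
      by_contra hpos
      push Not at hpos
      obtain ⟨n, hn⟩ := exists_nat_gt (M / 4 / y.1 0)
      have h1 := (hy n).2.1
      have : ε n < y.1 0 := by
        rw [hε, div_lt_iff₀ (by positivity)]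
        rw [div_lt_iff₀ hpos] at hn
        nlinarith
      linarith
    have hr : Kerr.radius a y.1 = 3 * M := by
      refine le_antisymm (hy 0).2.2.2 ?_
      by_contra hlt
      push Not at hlt
      obtain ⟨n, hn⟩ := exists_nat_gt (M / 4 / ((3 * M - Kerr.radius a y.1) / 2))
      have h1 := (hy n).2.2.1
      have hpos : 0 < (3 * M - Kerr.radius a y.1) / 2 := by linarith
      have : ε n < (3 * M - Kerr.radius a y.1) / 2 := by
        rw [hε, div_lt_iff₀ (by positivity)]
        rw [div_lt_iff₀ hpos] at hn
        nlinarith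
      linarith
    -- `y ∈ S₃ ⊆ roofP ⊆ O`
    have hyS : y ∈ slabK M a := ⟨ht, hr.le⟩
    have hyfr : y ∈ frontier (JK M a hM (slabK M a)) := by
      rw [hJc.frontier_eq]
      refine ⟨LorentzianMetric.subset_causalFuture (Kerr.spacetime M a M hM.le).metric _ _ hyS, fun hW => ?_⟩
      have := hW0 y hW; linarith
    exact hOo.mem_nhds (hOρ ⟨⟨hyfr, LorentzianMetric.subset_causalFuture (Kerr.spacetime M a M hM.le).metric _ _ ⟨ht, hr⟩⟩,
      by show Kerr.radius a y.1 ≤ ρ; rw [hr, hρ]; linarith⟩)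
  obtain ⟨n₀, hn₀⟩ := exists_subset_nhds_of_isCompact' hVdir hVc (fun n => (hVc n).isClosed) hVO
  /- ### `η` and the collar set -/
  set η := min (min δ₁ (ε n₀)) 1 / 2 with hη
  have hη0 : 0 < η := by rw [hη]; have := hεpos n₀; positivity
  have hηδ : η < δ₁ := by
    rw [hη]; have := min_le_left (min δ₁ (ε n₀)) 1; have := min_le_left δ₁ (ε n₀); linarith
  have hηε : η ≤ ε n₀ := by
    rw [hη]; have := min_le_left (min δ₁ (ε n₀)) 1; have := min_le_right δ₁ (ε n₀); linarith [hεpos n₀]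
  have hη1 : η ≤ 1 := by rw [hη]; have := min_le_right (min δ₁ (ε n₀)) 1; linarith
  set F : Set (Kerr.region a M) := {x | x ∈ W ∧ x.1 0 + 2 / 3 * Kerr.radius a x.1 < w₀ ∧ ∃ s, 0 < s ∧ s < η ∧
    (⟨x.1 + (-s) • E4.basisVector 0, translate_mem_region x (-s)⟩ : Kerr.region a M) ∉ JK M a hM (slabK M a)} with hFdef
  have hF : ∀ x : Kerr.region a M, x ∈ F ↔ x ∈ W ∧ x.1 0 + 2 / 3 * Kerr.radius a x.1 < w₀ ∧ ∃ s, 0 < s ∧ s < η ∧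
      (⟨x.1 + (-s) • E4.basisVector 0, translate_mem_region x (-s)⟩ : Kerr.region a M) ∉ JK M a hM (slabK M a) :=
    fun x => Iff.rfl
  -- `F ⊆ E`
  have hFE : F ⊆ E := by
    refine CollarK.collarSet_subset_collar hM ha hcyl hfr (ρ := ρ) (by rw [hρ]; linarith) hF ?_ ?_
    · intro x z hz h0 hw h3 hr hdist
      exact hδ₁O (mem_cthickening_of_dist_le x z δ₁ Kr ⟨hz, h0, hw, h3, hr⟩ (by linarith))
    · intro x h0 hη' h3 hr
      exact hn₀ ⟨h0, hη'.trans hηε, by linarith, hr⟩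
  /- ### `h` and the near-roof property -/
  set G : Set (Kerr.region a M) := {x | (⟨x.1 + (-(η / 2)) • E4.basisVector 0, translate_mem_region x (-(η / 2))⟩ :
    Kerr.region a M) ∉ JK M a hM (slabK M a)} with hG
  have hGo : IsOpen G := hJc.isOpen_compl.preimage (CollarK.continuous_translate.comp (Continuous.prodMk_right (-(η / 2))))
  have hKrG : Kr ⊆ G := fun y hy => CollarK.translate_neg_notMem_of_mem_roofK hM ha hcyl (hKrR hy).1 (half_pos hη0)
  obtain ⟨δ₂, hδ₂, hδ₂G⟩ := hKrc.exists_cthickening_subset_open hGo hKrG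
  set h := min (min (δ₂ / 2) (η / 8)) (M / 8) with hh
  have hh0 : 0 < h := by rw [hh]; positivity
  have hhδ : 2 * h ≤ δ₂ := by rw [hh]; have := min_le_left (min (δ₂ / 2) (η / 8)) (M / 8); have := min_le_left (δ₂ / 2) (η / 8); linarith
  have hhη : 8 * h ≤ η := by rw [hh]; have := min_le_left (min (δ₂ / 2) (η / 8)) (M / 8); have := min_le_right (δ₂ / 2) (η / 8); linarith
  have hhM : 4 * h < M := by rw [hh]; have := min_le_right (min (δ₂ / 2) (η / 8)) (M / 8); linarith
  have hnearF : ∀ x ∈ W, x.1 0 < T₁ → (∃ z ∈ frontier (JK M a hM (slabK M a)), 0 ≤ z.1 0 ∧ z.1 0 ≤ w₀ ∧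
      3 * M ≤ Kerr.radius a z.1 ∧ Kerr.radius a z.1 ≤ ρ ∧ dist x z ≤ 2 * h) → x ∈ F := by
    rintro x hxW hxT ⟨z, hz, h0, hw, h3, hr, hdist⟩
    refine (hF x).2 ⟨hxW, by nlinarith [hWr x hxW, Kerr.radius_nonneg a x.1], η / 2, half_pos hη0, by linarith, ?_⟩
    exact hδ₂G (mem_cthickening_of_dist_le x z δ₂ Kr ⟨hz, h0, hw, h3, hr⟩ (hdist.trans hhδ))
  have hlow : ∀ x ∈ W, x.1 0 < η → x ∈ F := fun x hxW hxt =>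
    CollarK.low_mem_collarSet hM ha hF hxW hxt (by nlinarith [hWr x hxW, Kerr.radius_nonneg a x.1])
  have hlocF : ∀ y ∈ slabK M a ∪ roofK M a hM ∩ {y | Kerr.radius a y.1 ≤ ρ}, ∃ Nb ∈ 𝓝 y,
      ∀ x ∈ Nb, x ∈ W → x.1 0 < T₁ → x ∈ F := by
    rintro y (hyS | ⟨hyR, hyρ⟩)
    · refine ⟨{x | x.1 0 < η}, (isOpen_lt (K2Route.continuous_tstar a M) continuous_const).mem_nhds
        (by show y.1 0 < η; rw [hyS.1]; exact hη0), fun x hx hxW _ => hlow x hxW hx⟩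
    · by_cases hyt : T₁ < y.1 0
      · exact ⟨{x | T₁ < x.1 0}, (isOpen_lt continuous_const (K2Route.continuous_tstar a M)).mem_nhds hyt,
          fun x hx _ hxT => absurd hxT (not_lt.2 (le_of_lt hx))⟩
      · push Not at hyt
        have hy0 : 0 ≤ y.1 0 := (FrontierK.JK_slabK_subset hM ha
          (hJc.closure_subset (frontier_subset_closure hyR.1))).1
        have hyKr : y ∈ Kr := ⟨hyR.1, hy0, hyt.trans (by rw [hw₀]; linarith), CollarK.radius_ge_of_mem_roofK hM ha hcyl hyR, hyρ⟩
        refine ⟨ball y (2 * h), ball_mem_nhds y (by linarith), fun x hx hxW hxT => hnearF x hxW hxT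
          ⟨y, hyR.1, hy0, hyt.trans (by rw [hw₀]; linarith), CollarK.radius_ge_of_mem_roofK hM ha hcyl hyR, hyρ,
            (mem_ball.1 hx).le⟩⟩
  refine ⟨O, F, ΨE, h, η, w₀, ρ, T₁, ⟨hh0, hhM, hhη, hη0, hη1, by rw [hT₁]; linarith, by rw [hw₀]; linarith,
    by rw [hw₀]; linarith, by rw [hρ]; linarith, by rw [hρ]; linarith⟩, hF, hOρ, hFE, hEo, hsE, heE, himgE, hdE, hcontE,
    hroofE, hslabE, hnearF, hlocF, hlow⟩

end SetupK

/-- **Registered bookkeeping sub-goal `stub_kerrSlabCornerFrontier` of the line** (brick of the landing of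
K2b-5 `stub_marchingLemma`): the outer edge sphere `S₃ = {t* = 0, r = 3M}` lies on the frontier of
`J⁺_K(slab)` (anchor of this file, whose content is the choice of the march data `SetupK.march_setup`).
[folklore] -/
theorem stub_kerrSlabCornerFrontier [Kerr.Facts] : ∀ (M a : ℝ) (hM : 0 < M), |a| < M →
    frontier (JK M a hM (slabK M a)) ⊆ slabK M a ∪ JK M a hM (outerSphereK M a) →
    outerSphereK M a ⊆ frontier (JK M a hM (slabK M a)) := by
  intro M a hM ha hfr y hy
  rw [(FutureK.isClosed_JK_slabK hM hfr).frontier_eq]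
  refine ⟨LorentzianMetric.subset_causalFuture (Kerr.spacetime M a M hM.le).metric _ _ ⟨hy.1, hy.2.le⟩, fun hW => ?_⟩
  have := FutureK.interior_JK_slabK_pos hM ha hW
  rw [hy.1] at this; exact lt_irrefl _ this

end Summit.FinalStateConjecture.FinalStateConjecture.Theorems.BondiBartnikRigidity.DirectMethod

end
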